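import Mathlib
import Literature.Geometry.DiscreteGeometry.TwoShellChartSemantics
import Summits.AtomisticToContinuum.Crystallization.Theorems.NashClassCertificatesNashNearFieldStubChartCoreLabels

/-!
# Crux `NashClassCertificates.NashNearField` (stmt-AtomisticToContinuum-16827), line `birth`,
# stub `stub_labelledPlacement` — soundness II: CRAMER PLACEMENTS bound the particles

With correct labels (`LabelsOK`), every placement entry produced by the checker bounds the particle of its label:
`placeLabel cs phi v tr w = some (P, d, num)` gives `d ≠ 0` and `‖pos (fP w) − P/d‖ ≤ num/(940|d|)` (`EntryBound`), by the
landed ℓ¹ Cramer bound `norm_sub_le_of_cramer` and the tolerance constants `1/20 = 47/940`, `ρ/20 ≤ 50/940`,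
`(1+ρ)/20 ≤ 97/940`.  Normalisation (`normEntry`) keeps the bound, the best entry over a menu (`bestOverMenu`) is such an
entry, and a placement table (`richTable`) therefore DESCRIBES the pivot (`TableDescribes`).
-/

noncomputable section

open Literature.Geometry.DiscreteGeometry Literature.Geometry.DiscreteGeometry.TwoShellCheck
  Literature.Geometry.DiscreteGeometry.TwoShellChart

namespace Summit.AtomisticToContinuum.Crystallization.Theorems.NashClassCertificatesNashNearField

variable {ι : Type*} {cen : List IVec} {pos : ι → EuclideanSpace ℝ (Fin 3)} {i₀ : ι} {fC : IVec → ι} {v : IVec}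
  {W : PivotW ι}

/-! ### Integer Cramer identity and its real form -/

/-- **Cramer's rule on triples**: `λ₁ w₁ + λ₂ w₂ + λ₃ w₃ = d • w`. -/
theorem cramer_vsum (w1 w2 w3 w : IVec) :
    vadd (vadd (vsmul (cramer w1 w2 w3 w).1 w1) (vsmul (cramer w1 w2 w3 w).2.1 w2)) (vsmul (cramer w1 w2 w3 w).2.2 w3) =
      vsmul (det3 w1 w2 w3) w := by
  obtain ⟨a1, a2, a3⟩ := w1
  obtain ⟨b1, b2, b3⟩ := w2
  obtain ⟨c1, c2, c3⟩ := w3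
  obtain ⟨x1, x2, x3⟩ := w
  simp only [cramer, det3, vadd, vsmul, Prod.mk.injEq]
  exact ⟨by ring, by ring, by ring⟩

/-- The real form of Cramer's rule: `d • pt w = Σ λₖ • pt wₖ`. -/
theorem cramer_pt (w1 w2 w3 w : IVec) :
    ((det3 w1 w2 w3 : ℤ) : ℝ) • pt w = ((cramer w1 w2 w3 w).1 : ℝ) • pt w1 + ((cramer w1 w2 w3 w).2.1 : ℝ) • pt w2 +
      ((cramer w1 w2 w3 w).2.2 : ℝ) • pt w3 := by
  have h := congrArg pt (cramer_vsum w1 w2 w3 w)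
  rw [pt_vsmul] at h
  rw [← h, pt_vadd, pt_vadd, pt_vsmul, pt_vsmul, pt_vsmul]

/-- `zabs` is the absolute value. -/
theorem cast_zabs (x : ℤ) : ((zabs x : ℤ) : ℝ) = |(x : ℝ)| := by
  unfold zabs
  split_ifs with h
  · rw [Int.cast_neg, abs_of_neg (by exact_mod_cast h)]
  · rw [abs_of_nonneg (by exact_mod_cast (not_lt.1 h))]

/-- `zabs x = 0 ↔ x = 0`. -/
theorem zabs_eq_zero_iff (x : ℤ) : zabs x = 0 ↔ x = 0 := by
  unfold zabs; split_ifs <;> omega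

/-- `0 ≤ zabs x`. -/
theorem zabs_nonneg (x : ℤ) : 0 ≤ zabs x := by unfold zabs; split_ifs <;> omega

/-- The tolerance of a common: `0` for the centre, `1/20` otherwise; it is `≤ (cwt c − 50·ρ-part)/940`, precisely
`tol c + ρ/20 ≤ cwt c / 940` for `ρ ≤ 50/47`. -/
theorem tol_add_le {ρ : ℝ} (hρ : ρ ≤ 50 / 47) (c : IVec) :
    (if c = ((0 : ℤ), (0 : ℤ), (0 : ℤ)) then (0 : ℝ) else 1 / 20) + ρ / 20 ≤ (cwt c : ℝ) / 940 := by
  unfold cwt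
  by_cases h : c = ((0 : ℤ), (0 : ℤ), (0 : ℤ))
  · subst h
    simp [veq]
    linarith
  · rw [if_neg h]
    have hb : ¬ veq c ((0 : ℤ), (0 : ℤ), (0 : ℤ)) = true := by
      intro hb
      apply h
      obtain ⟨a, b, c'⟩ := c
      simp only [veq, Bool.and_eq_true, beq_iff_eq] at hb
      rw [hb.1.1, hb.1.2, hb.2]
    rw [if_neg hb]
    push_cast
    linarith

/-- The particle of a common sits within its tolerance of `pt c`. -/
theorem norm_commonParticle_sub_le_tol (hC : CentreGood cen pos i₀ fC) {c : IVec} (hc : c ∈ commonsOf cen v) :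
    ‖pos (commonParticle i₀ fC c) - pt c‖ ≤ (if c = ((0 : ℤ), (0 : ℤ), (0 : ℤ)) then (0 : ℝ) else 1 / 20) := by
  obtain ⟨h0, hpat, -, -⟩ := hC
  unfold commonParticle
  split_ifs with h
  · subst h; rw [h0, pt_zero, sub_zero, norm_zero]
  · rcases (mem_commonsOf.1 hc).1 with h' | h'
    · exact absurd h' h
    · exact (hpat c h').2

/-! ### Soundness of `placeLabel` -/

/-- An index lookup `l[k]? = some a` gives the element at a valid index. -/
theorem getElem_of_getElem?_eq_some {α : Type*} {l : List α} {k : ℕ} {a : α} (h : l[k]? = some a) :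
    ∃ hk : k < l.length, l[k] = a := List.getElem?_eq_some_iff.1 h

/-- **Soundness of the Cramer placement.**  With correct labels, `placeLabel cs phi v tr w = some e` bounds the particle
of the label `w`: `EntryBound (pos (fP w)) e`. -/
theorem placeLabel_sound (hC : CentreGood cen pos i₀ fC) (hv : v ∈ cen) (hW : PivotGood pos (fC v) W)
    {cs phi : List IVec} (hcs : ∀ c ∈ cs, c ∈ commonsOf cen v) (hL : LabelsOK i₀ fC W cs phi)
    {tr : ℕ × ℕ × ℕ} {w : IVec} (hw : w ∈ modelList W.t) {e : Entry} (he : placeLabel cs phi v tr w = some e) :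
    EntryBound (pos (W.fP w)) e := by
  obtain ⟨hB, hρ1, hρ2, hpat, -, -⟩ := hW
  have hlen : cs.length = phi.length := hL.length_eq
  unfold placeLabel at he
  cases h1 : phi[tr.1]? with
  | none => simp [h1] at he
  | some w1 =>
  cases h2 : phi[tr.2.1]? with
  | none => simp [h1, h2] at he
  | some w2 =>
  cases h3 : phi[tr.2.2]? with
  | none => simp [h1, h2, h3] at he
  | some w3 =>
  cases h4 : cs[tr.1]? with
  | none => simp [h1, h2, h3, h4] at he
  | some c1 =>
  cases h5 : cs[tr.2.1]? with
  | none => simp [h1, h2, h3, h4, h5] at he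
  | some c2 =>
  cases h6 : cs[tr.2.2]? with
  | none => simp [h1, h2, h3, h4, h5, h6] at he
  | some c3 =>
  simp only [h1, h2, h3, h4, h5, h6] at he
  by_cases hd : det3 w1 w2 w3 = 0
  · simp [hd] at he
  · rw [if_neg (by simpa using hd)] at he
    simp only [Option.some.injEq] at he
    subst he
    obtain ⟨k1, hk1⟩ := getElem_of_getElem?_eq_some h1
    obtain ⟨k2, hk2⟩ := getElem_of_getElem?_eq_some h2
    obtain ⟨k3, hk3⟩ := getElem_of_getElem?_eq_some h3
    obtain ⟨j1, hj1⟩ := getElem_of_getElem?_eq_some h4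
    obtain ⟨j2, hj2⟩ := getElem_of_getElem?_eq_some h5
    obtain ⟨j3, hj3⟩ := getElem_of_getElem?_eq_some h6
    obtain ⟨hm1, hf1⟩ : w1 ∈ modelList W.t ∧ W.fP w1 = commonParticle i₀ fC c1 := by
      have := List.Forall₂.get hL j1 k1
      simp only [List.get_eq_getElem, hk1, hj1] at this
      exact this
    obtain ⟨hm2, hf2⟩ : w2 ∈ modelList W.t ∧ W.fP w2 = commonParticle i₀ fC c2 := by
      have := List.Forall₂.get hL j2 k2
      simp only [List.get_eq_getElem, hk2, hj2] at this
      exact this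
    obtain ⟨hm3, hf3⟩ : w3 ∈ modelList W.t ∧ W.fP w3 = commonParticle i₀ fC c3 := by
      have := List.Forall₂.get hL j3 k3
      simp only [List.get_eq_getElem, hk3, hj3] at this
      exact this
    have hc1 : c1 ∈ commonsOf cen v := hcs _ (hj1 ▸ List.getElem_mem j1)
    have hc2 : c2 ∈ commonsOf cen v := hcs _ (hj2 ▸ List.getElem_mem j2)
    have hc3 : c3 ∈ commonsOf cen v := hcs _ (hj3 ▸ List.getElem_mem j3)
    set d := det3 w1 w2 w3 with hddef
    set l := cramer w1 w2 w3 w with hldef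
    set tol : IVec → ℝ := fun c => if c = ((0 : ℤ), (0 : ℤ), (0 : ℤ)) then (0 : ℝ) else 1 / 20 with htol
    have key := norm_sub_le_of_cramer W.B (yj := pos (fC v)) (v := pt v)
      (y₁ := pos (commonParticle i₀ fC c1)) (y₂ := pos (commonParticle i₀ fC c2)) (y₃ := pos (commonParticle i₀ fC c3))
      (c₁ := pt c1) (c₂ := pt c2) (c₃ := pt c3) (w₁ := pt w1) (w₂ := pt w2) (w₃ := pt w3) (w := pt w)
      (y := pos (W.fP w)) (τ₀ := 1 / 20) (τ₁ := tol c1) (τ₂ := tol c2) (τ₃ := tol c3)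
      (ε₁ := W.ρ / 20) (ε₂ := W.ρ / 20) (ε₃ := W.ρ / 20) (ε := W.ρ / 20) (d := (d : ℝ)) (l₁ := (l.1 : ℝ))
      (l₂ := (l.2.1 : ℝ)) (l₃ := (l.2.2 : ℝ)) (hC.2.1 v hv).2
      (norm_commonParticle_sub_le_tol hC hc1) (norm_commonParticle_sub_le_tol hC hc2)
      (norm_commonParticle_sub_le_tol hC hc3)
      (by rw [← hf1]; exact (hpat w1 hm1).2) (by rw [← hf2]; exact (hpat w2 hm2).2) (by rw [← hf3]; exact (hpat w3 hm3).2)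
      (cramer_pt w1 w2 w3 w) (hpat w hw).2
    have hP : (d : ℝ) • pt v + ((l.1 : ℝ) • (pt c1 - pt v) + (l.2.1 : ℝ) • (pt c2 - pt v) + (l.2.2 : ℝ) • (pt c3 - pt v)) =
        pt (vadd (vsmul d v) (vadd (vadd (vsmul l.1 (vsub c1 v)) (vsmul l.2.1 (vsub c2 v))) (vsmul l.2.2 (vsub c3 v)))) := by
      simp only [pt_vadd, pt_vsmul, pt_vsub]
    rw [hP] at key
    have hrhs : |(d : ℝ) - ((l.1 : ℝ) + l.2.1 + l.2.2)| * (1 / 20) +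
        (|(l.1 : ℝ)| * (tol c1 + W.ρ / 20) + |(l.2.1 : ℝ)| * (tol c2 + W.ρ / 20) + |(l.2.2 : ℝ)| * (tol c3 + W.ρ / 20)) +
        |(d : ℝ)| * (W.ρ / 20) ≤
        ((47 * zabs (d - (l.1 + l.2.1 + l.2.2)) + 50 * zabs d +
          (zabs l.1 * cwt c1 + zabs l.2.1 * cwt c2 + zabs l.2.2 * cwt c3) : ℤ) : ℝ) / 940 := by
      have t1 := tol_add_le hρ2 c1
      have t2 := tol_add_le hρ2 c2
      have t3 := tol_add_le hρ2 c3
      push_cast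
      rw [cast_zabs, cast_zabs, cast_zabs, cast_zabs, cast_zabs]
      push_cast
      have a1 := abs_nonneg (l.1 : ℝ)
      have a2 := abs_nonneg (l.2.1 : ℝ)
      have a3 := abs_nonneg (l.2.2 : ℝ)
      have a0 := abs_nonneg (d : ℝ)
      have b1 := mul_le_mul_of_nonneg_left t1 a1
      have b2 := mul_le_mul_of_nonneg_left t2 a2
      have b3 := mul_le_mul_of_nonneg_left t3 a3
      nlinarith
    refine ⟨hd, ?_⟩
    have hd' : (d : ℝ) ≠ 0 := by exact_mod_cast hd
    have hdpos : 0 < |(d : ℝ)| := abs_pos.2 hd'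
    show ‖pos (W.fP w) - ((d : ℤ) : ℝ)⁻¹ • pt _‖ ≤ _
    have hscale : pos (W.fP w) - ((d : ℤ) : ℝ)⁻¹ •
        pt (vadd (vsmul d v) (vadd (vadd (vsmul l.1 (vsub c1 v)) (vsmul l.2.1 (vsub c2 v))) (vsmul l.2.2 (vsub c3 v)))) =
        ((d : ℝ))⁻¹ • ((d : ℝ) • pos (W.fP w) -
          pt (vadd (vsmul d v) (vadd (vadd (vsmul l.1 (vsub c1 v)) (vsmul l.2.1 (vsub c2 v))) (vsmul l.2.2 (vsub c3 v))))) := by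
      rw [smul_sub, smul_smul, inv_mul_cancel₀ hd', one_smul]
    rw [hscale, norm_smul, norm_inv, Real.norm_eq_abs, le_div_iff₀ (by positivity)]
    calc |(d : ℝ)|⁻¹ * ‖(d : ℝ) • pos (W.fP w) -
          pt (vadd (vsmul d v) (vadd (vadd (vsmul l.1 (vsub c1 v)) (vsmul l.2.1 (vsub c2 v))) (vsmul l.2.2 (vsub c3 v))))‖ *
          (940 * |((d : ℤ) : ℝ)|)
        = 940 * ‖(d : ℝ) • pos (W.fP w) -
          pt (vadd (vsmul d v) (vadd (vadd (vsmul l.1 (vsub c1 v)) (vsmul l.2.1 (vsub c2 v))) (vsmul l.2.2 (vsub c3 v))))‖ := by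
          field_simp
      _ ≤ _ := by
          have := key.trans hrhs
          rw [le_div_iff₀ (by norm_num)] at this
          linarith

/-! ### Normalisation keeps the bound -/

/-- Exact division of a triple by a common divisor, as model points: `pt P = g • pt (P/g)`. -/
theorem pt_div_exact {P : IVec} {g : ℤ} (h1 : g ∣ P.1) (h2 : g ∣ P.2.1) (h3 : g ∣ P.2.2) :
    pt P = (g : ℝ) • pt (P.1 / g, P.2.1 / g, P.2.2 / g) := by
  rw [← pt_vsmul]
  congr 1
  obtain ⟨a, b, c⟩ := P
  simp only [vsmul, Prod.mk.injEq]
  exact ⟨(Int.mul_ediv_cancel' h1).symm, (Int.mul_ediv_cancel' h2).symm, (Int.mul_ediv_cancel' h3).symm⟩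

/-- The sign flip does not change the placed point nor the error. -/
theorem entryBound_neg {y : EuclideanSpace ℝ (Fin 3)} {P : IVec} {d num : ℤ} (h : EntryBound y (P, d, num)) :
    EntryBound y (vsmul (-1) P, -d, num) := by
  obtain ⟨hd, hb⟩ := h
  refine ⟨by simpa using hd, ?_⟩
  simp only at hb ⊢
  rw [pt_vsmul]
  push_cast
  rw [abs_neg, smul_smul, show (-(d : ℝ))⁻¹ * -1 = ((d : ℝ))⁻¹ by rw [inv_neg, neg_mul_neg, mul_one]]
  exact hb

/-- **Normalisation keeps the bound.** -/
theorem normEntry_sound {y : EuclideanSpace ℝ (Fin 3)} {e : Entry} (h : EntryBound y e) : EntryBound y (normEntry e) := by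
  obtain ⟨P, d, num⟩ := e
  have hsign : EntryBound y ((if d < 0 then vsmul (-1) P else P), zabs d, num) := by
    unfold zabs
    split_ifs with hneg
    · exact entryBound_neg h
    · exact h
  unfold normEntry
  simp only
  set P' : IVec := if d < 0 then vsmul (-1) P else P with hP'
  set d' := zabs d with hd'
  set g : ℕ := Int.gcd (Int.gcd (Int.gcd P'.1 P'.2.1) (Int.gcd P'.2.2 d')) num with hg
  split_ifs with hg1
  · exact hsign
  · -- `g ≥ 2` divides everything
    have hg0 : (g : ℤ) ≠ 0 := by exact_mod_cast (show g ≠ 0 by omega)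
    have hgP12 : (g : ℤ) ∣ Int.gcd P'.1 P'.2.1 := by
      have := Int.gcd_dvd_left (Int.gcd (Int.gcd P'.1 P'.2.1) (Int.gcd P'.2.2 d') : ℤ) num
      rw [← hg] at this
      exact this.trans (Int.gcd_dvd_left _ _)
    have hgP3d : (g : ℤ) ∣ Int.gcd P'.2.2 d' := by
      have := Int.gcd_dvd_left (Int.gcd (Int.gcd P'.1 P'.2.1) (Int.gcd P'.2.2 d') : ℤ) num
      rw [← hg] at this
      exact this.trans (Int.gcd_dvd_right _ _)
    have h1 : (g : ℤ) ∣ P'.1 := hgP12.trans (Int.gcd_dvd_left _ _)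
    have h2 : (g : ℤ) ∣ P'.2.1 := hgP12.trans (Int.gcd_dvd_right _ _)
    have h3 : (g : ℤ) ∣ P'.2.2 := hgP3d.trans (Int.gcd_dvd_left _ _)
    have h4 : (g : ℤ) ∣ d' := hgP3d.trans (Int.gcd_dvd_right _ _)
    have h5 : (g : ℤ) ∣ num := by
      have := Int.gcd_dvd_right (Int.gcd (Int.gcd P'.1 P'.2.1) (Int.gcd P'.2.2 d') : ℤ) num
      rwa [← hg] at this
    obtain ⟨hd0, hb⟩ := hsign
    simp only at hd0 hb
    refine ⟨?_, ?_⟩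
    · simp only
      intro h0
      apply hd0
      have := Int.ediv_mul_cancel h4
      rw [h0, zero_mul] at this
      exact this.symm
    · simp only
      have hgR : (g : ℝ) ≠ 0 := by exact_mod_cast (show g ≠ 0 by omega)
      have e4 : ((d' / g : ℤ) : ℝ) = (d' : ℝ) / g := by
        rw [Int.cast_div h4 (by exact_mod_cast hg0)]; push_cast; ring
      have e5 : ((num / g : ℤ) : ℝ) = (num : ℝ) / g := by
        rw [Int.cast_div h5 (by exact_mod_cast hg0)]; push_cast; ring
      have ept : pt P' = (g : ℝ) • pt (P'.1 / g, P'.2.1 / g, P'.2.2 / g) := by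
        have := pt_div_exact h1 h2 h3
        push_cast at this
        exact this
      have hgpos : (0 : ℝ) < g := by positivity
      have : ((d' / g : ℤ) : ℝ)⁻¹ • pt (P'.1 / ↑g, P'.2.1 / ↑g, P'.2.2 / ↑g) = ((d' : ℤ) : ℝ)⁻¹ • pt P' := by
        rw [ept, smul_smul, e4]
        congr 1
        field_simp
      rw [this, e5, e4, abs_div, abs_of_pos hgpos]
      rw [show (num : ℝ) / g / (940 * (|(d' : ℝ)| / g)) = (num : ℝ) / (940 * |(d' : ℝ)|) by field_simp]
      exact hb

/-! ### Best entries and tables -/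

/-- **The best entry over a menu bounds the particle.** -/
theorem bestOverMenu_sound {y : EuclideanSpace ℝ (Fin 3)} {cs phi : List IVec} {v w : IVec}
    (hpl : ∀ tr e, placeLabel cs phi v tr w = some e → EntryBound y e) :
    ∀ (menu : List (ℕ × ℕ × ℕ)) {e : Entry}, bestOverMenu cs phi v menu w = some e → EntryBound y e := by
  suffices H : ∀ (menu : List (ℕ × ℕ × ℕ)) (acc : Option Entry), (∀ e, acc = some e → EntryBound y e) →
      ∀ e, menu.foldl (fun acc tr =>
        match placeLabel cs phi v tr w with
        | none => acc
        | some e =>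
          let e := normEntry e
          match acc with
          | none => some e
          | some b => if betterE e b then some e else some b) acc = some e → EntryBound y e by
    intro menu e he
    exact H menu none (fun e h => by simp at h) e he
  intro menu
  induction menu with
  | nil => intro acc hacc e he; exact hacc e (by simpa using he)
  | cons tr menu ih =>
    intro acc hacc e he
    rw [List.foldl_cons] at he
    refine ih _ ?_ e he
    intro e' he'
    cases hp : placeLabel cs phi v tr w with
    | none => rw [hp] at he'; exact hacc e' he'
    | some e0 =>
      rw [hp] at he'
      have hb0 : EntryBound y (normEntry e0) := normEntry_sound (hpl tr e0 hp)
      cases acc with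
      | none => simp only [Option.some.injEq] at he'; rw [← he']; exact hb0
      | some b =>
        simp only at he'
        split_ifs at he' with hbt
        · simp only [Option.some.injEq] at he'; rw [← he']; exact hb0
        · exact hacc e' he'

/-- One step of the fold defining `richTable`. -/
theorem richTable_cons (cs phi : List IVec) (v : IVec) (menu : List (ℕ × ℕ × ℕ)) (w : IVec) (piv : List IVec) :
    richTable cs phi v (w :: piv) menu =
      (match bestOverMenu cs phi v menu w, richTable cs phi v piv menu with
        | some e, some l => some (e :: l)
        | _, _ => none) := rfl

/-- **A placement table is the list of best entries** (in the order of the labels). -/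
theorem richTable_eq_map {cs phi : List IVec} {v : IVec} {menu : List (ℕ × ℕ × ℕ)} :
    ∀ (piv : List IVec) {T : List Entry}, richTable cs phi v piv menu = some T →
      T.length = piv.length ∧ ∀ k (hk : k < piv.length) (hk' : k < T.length),
        bestOverMenu cs phi v menu (piv[k]) = some (T[k])
  | [], T, h => by
    simp [richTable] at h
    subst h
    simp
  | w :: piv, T, h => by
    rw [richTable_cons] at h
    cases hb : bestOverMenu cs phi v menu w with
    | none => simp [hb] at h
    | some e =>
      cases hr : richTable cs phi v piv menu with
      | none => simp [hb, hr] at h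
      | some l =>
        simp only [hb, hr, Option.some.injEq] at h
        subst h
        obtain ⟨hl, hget⟩ := richTable_eq_map piv hr
        refine ⟨by simp [hl], fun k hk hk' => ?_⟩
        cases k with
        | zero => simpa using hb
        | succ k => simpa using hget k (by simpa using hk) (by simpa using hk')

/-- **A placement table of correct labels DESCRIBES the pivot.** -/
theorem richTable_describes (hC : CentreGood cen pos i₀ fC) (hv : v ∈ cen) (hW : PivotGood pos (fC v) W)
    {cs phi : List IVec} (hcs : ∀ c ∈ cs, c ∈ commonsOf cen v) (hL : LabelsOK i₀ fC W cs phi)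
    {menu : List (ℕ × ℕ × ℕ)} {T : List Entry} (hT : richTable cs phi v (modelList W.t) menu = some T) :
    TableDescribes pos W T := by
  classical
  obtain ⟨hlen, hget⟩ := richTable_eq_map (modelList W.t) hT
  -- the entry function
  let eo : IVec → Entry := fun w =>
    match bestOverMenu cs phi v menu w with
    | some e => e
    | none => (((0 : ℤ), (0 : ℤ), (0 : ℤ)), 0, 0)
  have heo : ∀ k (hk : k < (modelList W.t).length) (hk' : k < T.length), eo ((modelList W.t)[k]) = T[k] := by
    intro k hk hk'
    simp only [eo, hget k hk hk']
  refine ⟨eo, ?_, ?_⟩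
  · have : (modelList W.t).map eo = T := by
      apply List.ext_getElem (by simp [hlen])
      intro k hk hk'
      rw [List.getElem_map]
      exact heo k (by simpa using hk) hk'
    rw [this]
  · intro w hw
    obtain ⟨k, hk, rfl⟩ := List.mem_iff_getElem.1 hw
    have hk' : k < T.length := by omega
    rw [heo k hk hk']
    have := hget k hk hk'
    exact bestOverMenu_sound (fun tr e he => placeLabel_sound hC hv hW hcs hL (List.getElem_mem hk) he) menu this

/-- **Registered sub-goal `stub_labelledPlacementCramer` of crux stmt-AtomisticToContinuum-16827** (landing anchor of this file,
re-exporting `cramer_vsum`). -/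
theorem stub_labelledPlacementCramer : ∀ (w1 w2 w3 w : Literature.Geometry.DiscreteGeometry.TwoShellCheck.IVec), Literature.Geometry.DiscreteGeometry.TwoShellCheck.vadd (Literature.Geometry.DiscreteGeometry.TwoShellCheck.vadd (Literature.Geometry.DiscreteGeometry.TwoShellCheck.vsmul (Literature.Geometry.DiscreteGeometry.TwoShellCheck.cramer w1 w2 w3 w).1 w1) (Literature.Geometry.DiscreteGeometry.TwoShellCheck.vsmul (Literature.Geometry.DiscreteGeometry.TwoShellCheck.cramer w1 w2 w3 w).2.1 w2)) (Literature.Geometry.DiscreteGeometry.TwoShellCheck.vsmul (Literature.Geometry.DiscreteGeometry.TwoShellCheck.cramer w1 w2 w3 w).2.2 w3) = Literature.Geometry.DiscreteGeometry.TwoShellCheck.vsmul (Literature.Geometry.DiscreteGeometry.TwoShellCheck.det3 w1 w2 w3) w :=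
  cramer_vsum

end Summit.AtomisticToContinuum.Crystallization.Theorems.NashClassCertificatesNashNearField

end
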